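/-
Copyright: public-domain mathematics; typed transcription for the H21 Literature library (cell lit-balaban,
writer seat p40 gen 13 = literature-prover-lit-balaban-p40-g13-0; v1.1 docfix p40 gen 15 =
literature-prover-lit-balaban-p40-g15-0: p. 91 quotes «Q′(u₁, λ)» as printed (ref-1 gen 57 F4); declarations unchanged).

statement-level skeleton of published theorems with citation tags; proofs where landed; nothing here is a claim
about the Yang–Mills mass gap

# Bałaban, *Spaces of regular gauge field configurations on a lattice and gauge fixing conditions*, Commun. Math.
# Phys. **99** (1985) 75–102 [Balaban1985RegularSpaces], Theorem 4 p. 88 / p. 91: the «exactly one» clause for the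
# LINEAR restricted Landau problem «R(U)(T + Δ_U λ) = 0, Q′λ = 0», IN THE Ω₀ ⊂ T_η DIRICHLET PICTURE of [4] =
# [Balaban1985BackgroundPropagators] p. 394 — for the (3.18) block system constructed on Ω₀ (Ω₁-blocks ⊕ 0-blocks),
# every background; the explicit solution λ = −G′RT; and THE SOLUTION, READ ON T_η, DOES NOT DEPEND ON Ω₀.

THE PRINTED SENTENCES.  [B8] p. 88 [PDF 14]: «**Theorem 4.** There exists a constant c₁ such that for arbitrary U₀, U′U₀
satisfying (1.33), (1.34), (1.66) with α₀ + α₁ ≦ c₁ there exists exactly one gauge transformation u satisfying (1.29)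
and such that the conditions (1.37), (1.38), (1.62) hold for the configuration U₁ = U′^{u⁻¹}.»  [B8] p. 91 [PDF 17],
after (1.90) «…, Q′(u₁, λ) = 0. (1.90)»: «The function Q′(u₁, λ) is almost equal to Q′λ, the linear averaging operator
used in the definition of the operator R, the error is of second order in α₃, α₄. If it was equal to Q′λ, then
D*Dλ = Δλ would belong to the subspace R = ΔN(Q′) and we would have … Thus the main linear part in λ of the left-hand
side of (1.90) would be given by the invertible operator, the remaining terms being small.»; (1.91) «H′ =
G′²Q′*(Q′G′²Q′*)⁻¹, G′ = (Δ + Q′*aQ′)⁻¹. They were investigated in [4]».  [4] p. 394 [PDF 6] (text layer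
`paper:balaban1985-cmp99-background-propagators` p0006, verified for `B9Eq321DirichletIndependence`): «R = R(U) is an
orthogonal projection in the Hilbert space L²(Ω₀, 𝔤) onto the subspace ℛ = Δ^η_U N(Q′), N(Q′) = {λ : Q′λ = 0}. (3.21)
For an arbitrary function f ∈ L²(Ω₀, 𝔤) we have Rf = Δ^η_U λ₀ where λ₀ is a minimum of the function λ ∈ N(Q′) →
‖f − Δ^η_U λ‖². (3.22) In the above formulas Δ^η_U is the covariant Laplace operator Δ^η_U = D^{η*}_U D^η_U … (3.23)»;
«By the definition of space N(Q′) the functions λ in (3.22) vanish on Ω₁^c. This permits us to express R in terms of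
operators with some boundary conditions outside Ω₁. We will use only Dirichlet boundary conditions. Let us introduce
a domain Ω₀ such that Ω₁ ⊂ Ω₀ and Ω₀ is a union of big blocks of the lattice T₁ … For such Ω₀ we consider the
operator Δ′_a with Dirichlet boundary conditions on ∂Ω₀, i.e. the operator Δ′_a↾Ω₀ = Ω₀Δ′_aΩ₀. In the last
expression Ω₀ denotes a characteristic function of Ω₀ … The operators with the boundary conditions have a very
important property. They depend on the configuration U restricted to Ω₀. … Usually we will not mention it, and we
do not indicate this fact in our notations.»; «Rf = (I − G′Q′*(Q′G′²Q′*)⁻¹Q′G′)f, (3.25)».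

WHY THIS FILE (cell context).  r05՚s `B8Thm4FlatTorus` §§5–7 (gen 18) isolates the «exactly one» clause of Theorems
2/4 for the LINEAR problem of p. 91 as finite-dimensional linear algebra: abstractly for any restriction subspace N
with N ⊓ ker D = ⊥ (`existsUnique_restricted_landau_abstract`), on [4]՚s typed inputs `B9Eq325Proj.Data (D†D) Q′ …`
with the explicit solution λ = −G′RT (`existsUnique_restricted_landau_325`, `R325_landau_iff`), and on every plain
lattice system of `B9Thm311Lattice` (v1.3 `existsUnique_restricted_landau_lattice`); its B8-CLOSURE §5 item 2(i)
leaves «only a CONCRETE multi-level torus carrier».  This seat՚s gen-10–12 files typed [4]՚s own picture of p. 394: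
a domain Ω₀ ⊂ T_η containing Ω₁, the Dirichlet operator Ω₀Δ_TΩ₀ = `resS S ∘ₗ lapL τ bonds cb ∘ₗ extS S` on
L²(Ω₀, 𝔤) (`B9Eq323DirichletSplit`), the block system of (3.18) CONSTRUCTED on Ω₀ from the Ω₁-blocks and the
0-blocks of Λ₀ = Ω₀ ∖ Ω₁ (`B9Eq318DirichletBlocks.qS`), its (3.25)-data (`exists_data_qS`), the Ω₀-independence of
Ω₀R↾Ω₀ (`R325_dirichlet_indep`) and the printed multi-level cube geometry placed in T_η
(`B9Eq318EmbeddedLevels`).  THIS FILE runs r05՚s ∃!-clause ON THAT PICTURE and adds what only the Dirichlet picture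
can say: the solution does not depend on the auxiliary domain Ω₀.

CONTENT (theorems only; r05՚s `B8Eq127LandauGauge.IsLandauBG Δ Q′ X` = «R X = 0» in variational form is the B8
reading used in the statements).
* §1 **`adjoint_extS`** (Ω₀ and ↾Ω₀ are adjoint, operator form of `inner_extS_left`) and
  **`dirichlet_eq_adjoint_comp`**: the Dirichlet operator IS of the form D†D with D = D_U ∘ Ω₀ — «Δ^η_U = D^{η*}_U D^η_U
  (3.23)» together with «Δ′_a↾Ω₀ = Ω₀Δ′_aΩ₀» — so r05՚s §6 applies to it verbatim.
* §2 on every Ω₀ ⊇ Ω₁, for the constructed Q′ of (3.18): **`existsUnique_restricted_landau_dirichlet_of_data`** (any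
  Dirichlet (3.25)-datum: for every T ∈ L²(Ω₀, 𝔤) exactly one λ ∈ N(Q′) with R(T + Δλ) = 0),
  **`existsUnique_restricted_landau_dirichlet`** (the same with only printed hypotheses: injective transports
  isometric on the bonds entering Ω₀, c_b > 0, the Ω₁-blocks a block system — the datum comes from `exists_data_qS`),
  **`R325_landau_iff_dirichlet`** / **`isLandauBG_dirichlet_iff`** (λ = −G′RT with R the (3.25) operator of the
  Dirichlet problem, G′R = `B9Eq325Proj.lam0`), `restricted_landau_apply_eq_zero` (the solution vanishes on
  Λ₀ = Ω₀ ∖ Ω₁ — «the functions λ in (3.22) vanish on Ω₁^c»).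
* §3 **`extS_restricted_landau_indep`**: T_η with c_b > 0 and injective transports, ANY block system on Ω₁, two
  domains Ω₀ = S₁, Ω₀′ = S₂ containing Ω₁ and every site bonded to Ω₁, ANY Dirichlet (3.25)-data on them, one source
  T ∈ L²(T_η, 𝔤) restricted to each: the two restricted Landau parameters, extended by zero to T_η, COINCIDE — the
  p. 394 sentence «we do not indicate this fact [the choice of Ω₀] in our notations» for the solution of the linear
  gauge-fixing problem (via `R325_dirichlet_indep`, the support of Δ_T(Ω₀λ₀) and `lapL_qL_kernel` on the T_η-system).
* §4 **`existsUnique_restricted_landau_levels`** / **`extS_restricted_landau_indep_levels`**: §§2–3 for the printed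
  multi-level cube geometry 𝔅 = ⋃_j Λ_j placed in T_η (`B9Eq318EmbeddedLevels.isBlockSystem_levels_embed`), with
  purely geometric hypotheses.

HONEST SCOPE.  (i) The LINEAR problem only (p. 91՚s «main linear part»): the nonlinear (1.90) — «the error is of second
order in α₃, α₄», Sects. D–E — and every BOUND of Theorems 2/4 ((1.36)–(1.39), (1.62), (1.92)) are NOT touched; rows
B8.Thm2 / B8.Thm4 keep their heads.  (ii) Carriers: [4]՚s finite-lattice typing of this lineage (`B9Thm311Lattice` /
`B9Eq323DirichletSplit`): T_η any finite site set with a bond set and weights c_b, 𝔤 = V any finite-dimensional real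
inner-product space, R(U(b)) = injective linear maps τ, isometric on the bonds entering Ω₀ (unitary transports are);
the multi-level structure enters only through `IsBlockSystem` (weights unnormalised, DIVERGENCE D-b09.24); which cube
placements T_η admits is not modelled (§4 allows any embedding taking intra-cube bonds to bonds).  (iii) No estimate,
no measure; finite-dimensional linear algebra over r05՚s theorems and this lineage՚s Dirichlet dictionary; value = the
∃!-clause and its Ω₀-independence kernel-checked in [4]՚s own picture, NOT summit progress.
-/
import Mathlib
import Literature.MathematicalPhysics.QuantumFieldTheory.Balaban1983to89.B8Thm4FlatTorus
import Literature.MathematicalPhysics.QuantumFieldTheory.Balaban1983to89.B8Eq127LandauGauge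
import Literature.MathematicalPhysics.QuantumFieldTheory.Balaban1983to89.B9Eq318EmbeddedLevels

namespace Literature.MathematicalPhysics.QuantumFieldTheory.Balaban1983to89.B8Thm4LinearDirichlet

open Finset
open B9Thm311Lattice (IsBlockSystem qL DL lapL AL lapL_qL_kernel)
open B9Eq325Proj (Data lapKer R325 lam0)
open B9Eq323DirichletSplit (resS extS resT intBonds resS_apply extS_apply_coe)
open B9Eq321DirichletIndependence (inner_extS_right extS_resS_of_support lapL_extS_apply_eq_zero_of_layer)
open B9Eq318DirichletBlocks (qS qT isBlockSystem_T exists_data_qS apply_eq_zero_of_qS qS_ker_iff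
  R325_dirichlet_indep)
open B9Eq318EmbeddedLevels (embΩ embEquiv eqvW eqvB eqvΓ eqvY isBlockSystem_levels_embed)
open B9BlockSystemSigma (LSite LCentre sigBonds sigW sigB sigΓ sigY)
open B9BlockSystemCubes (bondsC wtC blockC pathC centreC)
open B8Eq127LandauGauge (IsLandauBG isLandauBG_iff_starProjection_eq_zero isLandauBG_iff_R325_eq_zero)
open B8Thm4FlatTorus (existsUnique_restricted_landau_325 restricted_landau_eq_neg_lam0 R325_landau_iff)
open scoped InnerProductSpace

variable {Xt : Type*} [Fintype Xt] [DecidableEq Xt] {V : Type*} [NormedAddCommGroup V] [InnerProductSpace ℝ V]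
  [FiniteDimensional ℝ V]

/-! ## §1  The Dirichlet operator Ω₀Δ_TΩ₀ is of the form D†D -/

section DaggerD

variable (S : Finset Xt)

/-- **Ω₀ and ↾Ω₀ are mutually adjoint, operator form**: the adjoint of the extension by zero
L²(Ω₀, 𝔤) → L²(T_η, 𝔤) is the restriction («In the last expression Ω₀ denotes a characteristic function of Ω₀»).
[cite: Balaban1985BackgroundPropagators, (3.23) p. 394] -/
theorem adjoint_extS :
    LinearMap.adjoint (extS S : PiLp 2 (fun _ : ↥S => V) →ₗ[ℝ] PiLp 2 (fun _ : Xt => V)) = resS S := by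
  symm
  rw [LinearMap.eq_adjoint_iff]
  intro g f
  exact (inner_extS_right S g f).symm

variable (τ : Xt → Xt → V →ₗ[ℝ] V) (bonds : Finset (Xt × Xt)) (cb : Xt × Xt → ℝ)

/-- **The Dirichlet operator is D†D**: Ω₀Δ_TΩ₀ = Ω₀D\*_U D_UΩ₀ = (D_UΩ₀)†(D_UΩ₀) on L²(Ω₀, 𝔤), with D_UΩ₀ = the
covariant derivative (3.3)/(3.23) of T_η applied to the extension by zero — «Δ^η_U = D^{η\*}_U D^η_U (3.23)» and
«Δ′_a↾Ω₀ = Ω₀Δ′_aΩ₀» (the Q′\*aQ′ part plays no role here).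
[cite: Balaban1985BackgroundPropagators, (3.23) p. 394] -/
theorem dirichlet_eq_adjoint_comp :
    resS S ∘ₗ lapL τ bonds cb ∘ₗ extS S
      = LinearMap.adjoint (DL τ bonds cb ∘ₗ extS S) ∘ₗ (DL τ bonds cb ∘ₗ extS S) := by
  rw [LinearMap.adjoint_comp, adjoint_extS]
  rfl

end DaggerD

/-! ## §2  «Exactly one» restricted Landau parameter in the Dirichlet picture, for the (3.18) system on Ω₀ -/

section Dirichlet

variable (Ω₁ : Finset Xt) (S : Finset Xt) (hΩ : Ω₁ ⊆ S) (τ : Xt → Xt → V →ₗ[ℝ] V)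
  (bonds : Finset (Xt × Xt)) (cb : Xt × Xt → ℝ) {Y : Type*} [Fintype Y]
  (w : Y → ↥Ω₁ → ℝ) (B : Y → Finset ↥Ω₁) (Γ : Y → ↥Ω₁ → List ↥Ω₁) (y : Y → ↥Ω₁)

/-- **THE «EXACTLY ONE» CLAUSE IN [4]՚S DIRICHLET PICTURE, for any Dirichlet (3.25)-datum.**  Ω₀ = S ⊇ Ω₁ a domain
of T_η; Δ = the Dirichlet operator Ω₀Δ_TΩ₀ on L²(Ω₀, 𝔤); Q′ = the CONSTRUCTED (3.18) system on Ω₀ (the Ω₁-blocks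
and, on Λ₀ = Ω₀ ∖ Ω₁, the 0-blocks {y} with (Q′λ)(y) = λ(y)); (Q′\*, a, G′, (Q′G′²Q′\*)⁻¹) any printed datum.  THEN
for every T ∈ L²(Ω₀, 𝔤) (T = D\*_U A′ in (1.90)) there is EXACTLY ONE λ with Q′λ = 0 and «R(T + Δλ) = 0»
(`IsLandauBG`: T + Δλ ⊥ Δ N(Q′), R the orthogonal projection of (3.21)) — p. 91 «the main linear part in λ of
the left-hand side of (1.90) would be given by the invertible operator»; r05՚s `existsUnique_restricted_landau_325`
after §1. [cite: Balaban1985RegularSpaces, Thm 4 p.88, (1.90)–(1.91) p.91, (1.27) p.80;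
Balaban1985BackgroundPropagators, (3.18) p.393, (3.21)–(3.25) p.394] -/
theorem existsUnique_restricted_landau_dirichlet_of_data
    {qs : PiLp 2 (fun _ : Y ⊕ {x : ↥S // (x : Xt) ∉ Ω₁} => V) →ₗ[ℝ] PiLp 2 (fun _ : ↥S => V)}
    {A cc : PiLp 2 (fun _ : Y ⊕ {x : ↥S // (x : Xt) ∉ Ω₁} => V) →ₗ[ℝ]
      PiLp 2 (fun _ : Y ⊕ {x : ↥S // (x : Xt) ∉ Ω₁} => V)}
    {g : PiLp 2 (fun _ : ↥S => V) →ₗ[ℝ] PiLp 2 (fun _ : ↥S => V)}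
    (h : Data (resS S ∘ₗ lapL τ bonds cb ∘ₗ extS S) (qS Ω₁ S hΩ τ w B Γ y) qs A g cc)
    (T : PiLp 2 (fun _ : ↥S => V)) :
    ∃! lam : LinearMap.ker (qS Ω₁ S hΩ τ w B Γ y),
      IsLandauBG (resS S ∘ₗ lapL τ bonds cb ∘ₗ extS S) (qS Ω₁ S hΩ τ w B Γ y)
        (T + (resS S ∘ₗ lapL τ bonds cb ∘ₗ extS S) (lam : PiLp 2 (fun _ : ↥S => V))) := by
  rw [dirichlet_eq_adjoint_comp] at h ⊢
  simp only [isLandauBG_iff_starProjection_eq_zero]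
  exact existsUnique_restricted_landau_325 _ h T

/-- **THE SAME WITH ONLY THE PRINTED HYPOTHESES** — injective transports R(U(b)) that are isometries on the bonds
entering Ω₀ (unitary transports are), bond weights c_b > 0, the Ω₁-blocks a block system for the bonds inside Ω₁:
the (3.25)-datum is supplied by Theorem 3.11 «obvious for the first three operators»
(`B9Eq318DirichletBlocks.exists_data_qS`, level weights a = 1 — R does not depend on a). For every T ∈ L²(Ω₀, 𝔤)
there is exactly one λ ∈ N(Q′) with R(T + Δλ) = 0. [cite: Balaban1985RegularSpaces, Thm 4 p.88, (1.90)–(1.91) p.91;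
Balaban1985BackgroundPropagators, (3.18) p.393, (3.21)–(3.25) p.394, Thm 3.11 p.416] -/
theorem existsUnique_restricted_landau_dirichlet (hinj : ∀ x x' : Xt, Function.Injective (τ x x'))
    (hcb : ∀ b ∈ bonds, 0 < cb b)
    (hiso : ∀ b ∈ bonds, b.1 ∉ S → b.2 ∈ S → ∀ u v : V, ⟪τ b.1 b.2 u, τ b.1 b.2 v⟫_ℝ = ⟪u, v⟫_ℝ)
    (hS : IsBlockSystem (intBonds Ω₁ bonds) w B Γ y) (T : PiLp 2 (fun _ : ↥S => V)) :
    ∃! lam : LinearMap.ker (qS Ω₁ S hΩ τ w B Γ y),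
      IsLandauBG (resS S ∘ₗ lapL τ bonds cb ∘ₗ extS S) (qS Ω₁ S hΩ τ w B Γ y)
        (T + (resS S ∘ₗ lapL τ bonds cb ∘ₗ extS S) (lam : PiLp 2 (fun _ : ↥S => V))) := by
  obtain ⟨g, cc, h⟩ :=
    exists_data_qS Ω₁ τ bonds cb w B Γ y S hΩ hinj hcb hiso hS (fun _ => 1) fun _ => one_pos
  exact existsUnique_restricted_landau_dirichlet_of_data Ω₁ S hΩ τ bonds cb w B Γ y h T

/-- **IN PRINT՚S OWN LETTERS**: with R = I − G′Q′\*(Q′G′²Q′\*)⁻¹Q′G′ the (3.25) operator of the Dirichlet problem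
(`R325`) and G′R = `lam0` ((3.22) «Rf = Δ^η_U λ₀»), for Q′λ = 0: R(T + Δλ) = 0 ↔ λ = −G′RT.
[cite: Balaban1985RegularSpaces, Thm 4 p.88, p.91, (1.91); Balaban1985BackgroundPropagators, (3.22)+(3.25) p.394] -/
theorem R325_landau_iff_dirichlet
    {qs : PiLp 2 (fun _ : Y ⊕ {x : ↥S // (x : Xt) ∉ Ω₁} => V) →ₗ[ℝ] PiLp 2 (fun _ : ↥S => V)}
    {A cc : PiLp 2 (fun _ : Y ⊕ {x : ↥S // (x : Xt) ∉ Ω₁} => V) →ₗ[ℝ]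
      PiLp 2 (fun _ : Y ⊕ {x : ↥S // (x : Xt) ∉ Ω₁} => V)}
    {g : PiLp 2 (fun _ : ↥S => V) →ₗ[ℝ] PiLp 2 (fun _ : ↥S => V)}
    (h : Data (resS S ∘ₗ lapL τ bonds cb ∘ₗ extS S) (qS Ω₁ S hΩ τ w B Γ y) qs A g cc)
    (T lam : PiLp 2 (fun _ : ↥S => V)) (hq : qS Ω₁ S hΩ τ w B Γ y lam = 0) :
    R325 (qS Ω₁ S hΩ τ w B Γ y) qs g cc (T + (resS S ∘ₗ lapL τ bonds cb ∘ₗ extS S) lam) = 0 ↔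
      lam = -(lam0 (qS Ω₁ S hΩ τ w B Γ y) qs g cc T) := by
  rw [dirichlet_eq_adjoint_comp] at h ⊢
  exact R325_landau_iff _ h T lam hq

/-- The variational reading: for Q′λ = 0, «R(T + Δλ) = 0» (`IsLandauBG`, r05՚s typing of (1.27)/(1.38)) ↔ λ = −G′RT.
[cite: Balaban1985RegularSpaces, (1.27) p.80, Thm 4 p.88, p.91; Balaban1985BackgroundPropagators, (3.22)+(3.25) p.394] -/
theorem isLandauBG_dirichlet_iff
    {qs : PiLp 2 (fun _ : Y ⊕ {x : ↥S // (x : Xt) ∉ Ω₁} => V) →ₗ[ℝ] PiLp 2 (fun _ : ↥S => V)}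
    {A cc : PiLp 2 (fun _ : Y ⊕ {x : ↥S // (x : Xt) ∉ Ω₁} => V) →ₗ[ℝ]
      PiLp 2 (fun _ : Y ⊕ {x : ↥S // (x : Xt) ∉ Ω₁} => V)}
    {g : PiLp 2 (fun _ : ↥S => V) →ₗ[ℝ] PiLp 2 (fun _ : ↥S => V)}
    (h : Data (resS S ∘ₗ lapL τ bonds cb ∘ₗ extS S) (qS Ω₁ S hΩ τ w B Γ y) qs A g cc)
    (T lam : PiLp 2 (fun _ : ↥S => V)) (hq : qS Ω₁ S hΩ τ w B Γ y lam = 0) :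
    IsLandauBG (resS S ∘ₗ lapL τ bonds cb ∘ₗ extS S) (qS Ω₁ S hΩ τ w B Γ y)
        (T + (resS S ∘ₗ lapL τ bonds cb ∘ₗ extS S) lam) ↔
      lam = -(lam0 (qS Ω₁ S hΩ τ w B Γ y) qs g cc T) := by
  rw [isLandauBG_iff_R325_eq_zero h]
  exact R325_landau_iff_dirichlet Ω₁ S hΩ τ bonds cb w B Γ y h T lam hq

omit [Fintype Xt] [FiniteDimensional ℝ V] [Fintype Y] in
/-- **The restricted parameter vanishes on Λ₀ = Ω₀ ∖ Ω₁**: «By the definition of space N(Q′) the functions λ in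
(3.22) vanish on Ω₁^c» — for the constructed system every site of Λ₀ is a 0-block with weight 1.
[cite: Balaban1985BackgroundPropagators, (3.18) p.393, p.394] -/
theorem restricted_landau_apply_eq_zero (lam : LinearMap.ker (qS Ω₁ S hΩ τ w B Γ y)) (x : ↥S)
    (hx : (x : Xt) ∉ Ω₁) : (lam : PiLp 2 (fun _ : ↥S => V)) x = 0 :=
  apply_eq_zero_of_qS Ω₁ S hΩ τ w B Γ y _ (LinearMap.mem_ker.mp lam.2) x hx

end Dirichlet

/-! ## §3  The restricted Landau parameter, read on T_η, does not depend on the auxiliary domain Ω₀ -/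

section Independence

variable (Ω₁ : Finset Xt) (τ : Xt → Xt → V →ₗ[ℝ] V) (bonds : Finset (Xt × Xt)) (cb : Xt × Xt → ℝ)
  {Y : Type*} [Fintype Y] (w : Y → ↥Ω₁ → ℝ) (B : Y → Finset ↥Ω₁) (Γ : Y → ↥Ω₁ → List ↥Ω₁) (y : Y → ↥Ω₁)

omit [Fintype Y] in
/-- **Ω₀(Ω₀Δ_TΩ₀λ) = Δ_T(Ω₀λ) for λ ∈ N(Q′)**: a restricted parameter vanishes on Λ₀ = Ω₀ ∖ Ω₁ («the functions λ
in (3.22) vanish on Ω₁^c»), and no bond of T_η joins Ω₁ to T_η ∖ Ω₀ («we may add to Ω₁ a thinner layer of the big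
blocks surrounding Ω₁»), so Δ_T(Ω₀λ) is already supported in Ω₀ — the Dirichlet cut-off loses nothing on N(Q′).
[cite: Balaban1985BackgroundPropagators, (3.18) p.393, (3.23) p.394] -/
theorem extS_dirichlet_apply_of_ker (hcb : ∀ b ∈ bonds, 0 ≤ cb b) (S : Finset Xt) (hΩ : Ω₁ ⊆ S)
    (hlayer : ∀ b ∈ bonds, (b.1 ∈ Ω₁ → b.2 ∈ S) ∧ (b.2 ∈ Ω₁ → b.1 ∈ S))
    (lam : PiLp 2 (fun _ : ↥S => V)) (hq : qS Ω₁ S hΩ τ w B Γ y lam = 0) :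
    extS S ((resS S ∘ₗ lapL τ bonds cb ∘ₗ extS S) lam) = lapL τ bonds cb (extS S lam) :=
  extS_resS_of_support S _ fun z hz =>
    lapL_extS_apply_eq_zero_of_layer S τ bonds cb hcb Ω₁ hlayer lam
      (fun x hx => apply_eq_zero_of_qS Ω₁ S hΩ τ w B Γ y lam hq x hx) z hz

/-- **THE SOLUTION OF THE LINEAR GAUGE-FIXING PROBLEM DOES NOT DEPEND ON Ω₀.**  T_η with bond weights c_b > 0 and
injective transports R(U(b)); ANY block system on Ω₁ (the blocks of order ≥ 1); two admissible auxiliary domains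
Ω₀ = S₁, Ω₀′ = S₂ — each containing Ω₁ and every site bonded to Ω₁ — with the CONSTRUCTED (3.18) systems Q′, Q′′
and ANY Dirichlet (3.25)-data on them (existence: `exists_data_qS` when the transports entering the domain are
isometries); one source T ∈ L²(T_η, 𝔤), restricted to each domain.  If λ₁ ∈ N(Q′) solves «R(T↾Ω₀ + Δλ₁) = 0» on Ω₀
and λ₂ ∈ N(Q′′) solves «R′(T↾Ω₀′ + Δ′λ₂) = 0» on Ω₀′, then Ω₀λ₁ = Ω₀′λ₂ as functions on T_η.  Mechanism: λᵢ =
−G′ᵢRᵢ(T↾Ωᵢ) (§2); Δ_T(Ω₀G′R(T↾Ω₀)) = Ω₀R(T↾Ω₀) is Ω₀-independent (`B9Eq318DirichletBlocks.R325_dirichlet_indep` and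
`extS_dirichlet_apply_of_ker`); and Δ_Tμ = 0, Q_Tμ = 0 force μ = 0 on the T_η-system (Theorem 3.11՚s kernel lemma
`B9Thm311Lattice.lapL_qL_kernel`, every site off Ω₁ being a 0-block).  This is p. 394՚s «Usually we will not mention
it [the Dirichlet domain Ω₀], and we do not indicate this fact in our notations» for the gauge-fixing parameter of
Theorem 4՚s linear problem. [cite: Balaban1985RegularSpaces, Thm 4 p.88, (1.90)–(1.91) p.91;
Balaban1985BackgroundPropagators, (3.18) p.393, (3.21)–(3.25) p.394, Thm 3.11 p.416] -/
theorem extS_restricted_landau_indep (hinj : ∀ x x' : Xt, Function.Injective (τ x x'))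
    (hcb : ∀ b ∈ bonds, 0 < cb b) (hS : IsBlockSystem (intBonds Ω₁ bonds) w B Γ y)
    (S₁ S₂ : Finset Xt) (hΩ₁ : Ω₁ ⊆ S₁) (hΩ₂ : Ω₁ ⊆ S₂)
    (hlayer₁ : ∀ b ∈ bonds, (b.1 ∈ Ω₁ → b.2 ∈ S₁) ∧ (b.2 ∈ Ω₁ → b.1 ∈ S₁))
    (hlayer₂ : ∀ b ∈ bonds, (b.1 ∈ Ω₁ → b.2 ∈ S₂) ∧ (b.2 ∈ Ω₁ → b.1 ∈ S₂))
    {qs₁ : PiLp 2 (fun _ : Y ⊕ {x : ↥S₁ // (x : Xt) ∉ Ω₁} => V) →ₗ[ℝ] PiLp 2 (fun _ : ↥S₁ => V)}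
    {A₁ c₁ : PiLp 2 (fun _ : Y ⊕ {x : ↥S₁ // (x : Xt) ∉ Ω₁} => V) →ₗ[ℝ]
      PiLp 2 (fun _ : Y ⊕ {x : ↥S₁ // (x : Xt) ∉ Ω₁} => V)}
    {g₁ : PiLp 2 (fun _ : ↥S₁ => V) →ₗ[ℝ] PiLp 2 (fun _ : ↥S₁ => V)}
    {qs₂ : PiLp 2 (fun _ : Y ⊕ {x : ↥S₂ // (x : Xt) ∉ Ω₁} => V) →ₗ[ℝ] PiLp 2 (fun _ : ↥S₂ => V)}
    {A₂ c₂ : PiLp 2 (fun _ : Y ⊕ {x : ↥S₂ // (x : Xt) ∉ Ω₁} => V) →ₗ[ℝ]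
      PiLp 2 (fun _ : Y ⊕ {x : ↥S₂ // (x : Xt) ∉ Ω₁} => V)}
    {g₂ : PiLp 2 (fun _ : ↥S₂ => V) →ₗ[ℝ] PiLp 2 (fun _ : ↥S₂ => V)}
    (h₁ : Data (resS S₁ ∘ₗ lapL τ bonds cb ∘ₗ extS S₁) (qS Ω₁ S₁ hΩ₁ τ w B Γ y) qs₁ A₁ g₁ c₁)
    (h₂ : Data (resS S₂ ∘ₗ lapL τ bonds cb ∘ₗ extS S₂) (qS Ω₁ S₂ hΩ₂ τ w B Γ y) qs₂ A₂ g₂ c₂)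
    (T : PiLp 2 (fun _ : Xt => V)) {lam₁ : PiLp 2 (fun _ : ↥S₁ => V)} {lam₂ : PiLp 2 (fun _ : ↥S₂ => V)}
    (hq₁ : qS Ω₁ S₁ hΩ₁ τ w B Γ y lam₁ = 0) (hq₂ : qS Ω₁ S₂ hΩ₂ τ w B Γ y lam₂ = 0)
    (hL₁ : IsLandauBG (resS S₁ ∘ₗ lapL τ bonds cb ∘ₗ extS S₁) (qS Ω₁ S₁ hΩ₁ τ w B Γ y)
      (resS S₁ T + (resS S₁ ∘ₗ lapL τ bonds cb ∘ₗ extS S₁) lam₁))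
    (hL₂ : IsLandauBG (resS S₂ ∘ₗ lapL τ bonds cb ∘ₗ extS S₂) (qS Ω₁ S₂ hΩ₂ τ w B Γ y)
      (resS S₂ T + (resS S₂ ∘ₗ lapL τ bonds cb ∘ₗ extS S₂) lam₂)) :
    extS S₁ lam₁ = extS S₂ lam₂ := by
  have hcb' : ∀ b ∈ bonds, 0 ≤ cb b := fun b hb => (hcb b hb).le
  -- Step 1 (§2): the explicit formula λᵢ = −G′ᵢRᵢ(T↾Ωᵢ) on each domain
  rw [(isLandauBG_dirichlet_iff Ω₁ S₁ hΩ₁ τ bonds cb w B Γ y h₁ (resS S₁ T) lam₁ hq₁).1 hL₁,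
    (isLandauBG_dirichlet_iff Ω₁ S₂ hΩ₂ τ bonds cb w B Γ y h₂ (resS S₂ T) lam₂ hq₂).1 hL₂, map_neg, map_neg]
  have hq0₁ := h₁.q_lam0 (resS S₁ T)
  have hq0₂ := h₂.q_lam0 (resS S₂ T)
  -- Step 2: Δ_T(Ω₀λ₀) = Ω₀R(T↾Ω₀) = Ω₀′R′(T↾Ω₀′) = Δ_T(Ω₀′λ₀′)
  have hR := LinearMap.congr_fun
    (R325_dirichlet_indep Ω₁ τ bonds cb w B Γ y hcb' S₁ S₂ hΩ₁ hΩ₂ hlayer₁ hlayer₂ h₁ h₂) T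
  simp only [LinearMap.comp_apply] at hR
  rw [h₁.R325_eq_lap_lam0, h₂.R325_eq_lap_lam0,
    extS_dirichlet_apply_of_ker Ω₁ τ bonds cb w B Γ y hcb' S₁ hΩ₁ hlayer₁ _ hq0₁,
    extS_dirichlet_apply_of_ker Ω₁ τ bonds cb w B Γ y hcb' S₂ hΩ₂ hlayer₂ _ hq0₂] at hR
  -- Step 3: the difference lies in N(Q_T) and is annihilated by Δ_T, hence vanishes (Thm 3.11 kernel lemma)
  have hQ₁ : qT Ω₁ τ w B Γ y (extS S₁ (lam0 (qS Ω₁ S₁ hΩ₁ τ w B Γ y) qs₁ g₁ c₁ (resS S₁ T))) = 0 :=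
    (qS_ker_iff Ω₁ S₁ hΩ₁ τ w B Γ y _).1 hq0₁
  have hQ₂ : qT Ω₁ τ w B Γ y (extS S₂ (lam0 (qS Ω₁ S₂ hΩ₂ τ w B Γ y) qs₂ g₂ c₂ (resS S₂ T))) = 0 :=
    (qS_ker_iff Ω₁ S₂ hΩ₂ τ w B Γ y _).1 hq0₂
  have hzero : extS S₁ (lam0 (qS Ω₁ S₁ hΩ₁ τ w B Γ y) qs₁ g₁ c₁ (resS S₁ T))
      - extS S₂ (lam0 (qS Ω₁ S₂ hΩ₂ τ w B Γ y) qs₂ g₂ c₂ (resS S₂ T)) = 0 := by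
    refine lapL_qL_kernel τ hinj cb hcb (isBlockSystem_T Ω₁ hS) _ ?_ ?_
    · rw [map_sub, hR, sub_self, inner_zero_right]
    · show qT Ω₁ τ w B Γ y _ = 0
      rw [map_sub, hQ₁, hQ₂, sub_zero]
  rw [sub_eq_zero.mp hzero]

end Independence

/-! ## §4  The instance on the printed multi-level cube geometry placed in T_η -/

section Levels

variable {J : Type*} [Fintype J] [DecidableEq J] (d : ℕ) (M l : J → ℕ) (emb : LSite d M l ↪ Xt)
  (τ : Xt → Xt → V →ₗ[ℝ] V) (bonds : Finset (Xt × Xt)) (cb : Xt × Xt → ℝ)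

/-- **«EXACTLY ONE» ON THE PRINTED GEOMETRY.**  The multi-level cube geometry 𝔅 = ⋃_j Λ_j of (3.18) (level j:
M_j^d cubes of side l_j + 1 with their weights, axial contours and centres, `B9BlockSystemSigma`) placed in T_η by
any embedding taking intra-cube bonds to bonds of T_η; Ω₁ := its image; ANY Ω₀ ⊇ Ω₁; injective transports isometric
on the bonds entering Ω₀; c_b > 0.  Then for every T ∈ L²(Ω₀, 𝔤) there is exactly one λ ∈ N(Q′) with
R(T + Δλ) = 0 in the Dirichlet picture — §2 with `B9Eq318EmbeddedLevels.isBlockSystem_levels_embed`.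
[cite: Balaban1985RegularSpaces, Thm 4 p.88, (1.90)–(1.91) p.91; Balaban1985BackgroundPropagators, (3.18) p.393,
(3.21)–(3.25) p.394, Thm 3.11 p.416; Balaban1985Averaging, (2)-(3) p.17] -/
theorem existsUnique_restricted_landau_levels
    (hb : ∀ a b, (a, b) ∈ sigBonds (fun j => bondsC d (M j) (l j)) → (emb a, emb b) ∈ bonds)
    (S : Finset Xt) (hΩ : embΩ emb ⊆ S) (hinj : ∀ x x' : Xt, Function.Injective (τ x x'))
    (hcb : ∀ b ∈ bonds, 0 < cb b)
    (hiso : ∀ b ∈ bonds, b.1 ∉ S → b.2 ∈ S → ∀ u v : V, ⟪τ b.1 b.2 u, τ b.1 b.2 v⟫_ℝ = ⟪u, v⟫_ℝ)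
    (T : PiLp 2 (fun _ : ↥S => V)) :
    ∃! lam : LinearMap.ker (qS (embΩ emb) S hΩ τ (eqvW (embEquiv emb) (sigW fun j => wtC d (M j) (l j)))
        (eqvB (embEquiv emb) (sigB fun j => blockC d (M j) (l j)))
        (eqvΓ (embEquiv emb) (sigΓ fun j => pathC d (M j) (l j)))
        (eqvY (embEquiv emb) (sigY fun j => centreC d (M j) (l j)))),
      IsLandauBG (resS S ∘ₗ lapL τ bonds cb ∘ₗ extS S)
        (qS (embΩ emb) S hΩ τ (eqvW (embEquiv emb) (sigW fun j => wtC d (M j) (l j)))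
          (eqvB (embEquiv emb) (sigB fun j => blockC d (M j) (l j)))
          (eqvΓ (embEquiv emb) (sigΓ fun j => pathC d (M j) (l j)))
          (eqvY (embEquiv emb) (sigY fun j => centreC d (M j) (l j))))
        (T + (resS S ∘ₗ lapL τ bonds cb ∘ₗ extS S) (lam : PiLp 2 (fun _ : ↥S => V))) :=
  existsUnique_restricted_landau_dirichlet (embΩ emb) S hΩ τ bonds cb _ _ _ _ hinj hcb hiso
    (isBlockSystem_levels_embed d M l emb bonds hb) T

/-- **Ω₀-INDEPENDENCE ON THE PRINTED GEOMETRY**: §3 `extS_restricted_landau_indep` for the (3.18)-system of the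
embedded multi-level cubes — two admissible domains (each ⊇ Ω₁ + the bonded layer) with any Dirichlet (3.25)-data,
one source on T_η: the restricted Landau parameters agree as functions on T_η.
[cite: Balaban1985RegularSpaces, Thm 4 p.88, p.91; Balaban1985BackgroundPropagators, (3.18) p.393, (3.21)–(3.25)
p.394, Thm 3.11 p.416] -/
theorem extS_restricted_landau_indep_levels
    (hb : ∀ a b, (a, b) ∈ sigBonds (fun j => bondsC d (M j) (l j)) → (emb a, emb b) ∈ bonds)
    (hinj : ∀ x x' : Xt, Function.Injective (τ x x')) (hcb : ∀ b ∈ bonds, 0 < cb b)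
    (S₁ S₂ : Finset Xt) (hΩ₁ : embΩ emb ⊆ S₁) (hΩ₂ : embΩ emb ⊆ S₂)
    (hlayer₁ : ∀ b ∈ bonds, (b.1 ∈ embΩ emb → b.2 ∈ S₁) ∧ (b.2 ∈ embΩ emb → b.1 ∈ S₁))
    (hlayer₂ : ∀ b ∈ bonds, (b.1 ∈ embΩ emb → b.2 ∈ S₂) ∧ (b.2 ∈ embΩ emb → b.1 ∈ S₂))
    {qs₁ : PiLp 2 (fun _ : LCentre d M ⊕ {x : ↥S₁ // (x : Xt) ∉ embΩ emb} => V) →ₗ[ℝ] PiLp 2 (fun _ : ↥S₁ => V)}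
    {A₁ c₁ : PiLp 2 (fun _ : LCentre d M ⊕ {x : ↥S₁ // (x : Xt) ∉ embΩ emb} => V) →ₗ[ℝ]
      PiLp 2 (fun _ : LCentre d M ⊕ {x : ↥S₁ // (x : Xt) ∉ embΩ emb} => V)}
    {g₁ : PiLp 2 (fun _ : ↥S₁ => V) →ₗ[ℝ] PiLp 2 (fun _ : ↥S₁ => V)}
    {qs₂ : PiLp 2 (fun _ : LCentre d M ⊕ {x : ↥S₂ // (x : Xt) ∉ embΩ emb} => V) →ₗ[ℝ] PiLp 2 (fun _ : ↥S₂ => V)}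
    {A₂ c₂ : PiLp 2 (fun _ : LCentre d M ⊕ {x : ↥S₂ // (x : Xt) ∉ embΩ emb} => V) →ₗ[ℝ]
      PiLp 2 (fun _ : LCentre d M ⊕ {x : ↥S₂ // (x : Xt) ∉ embΩ emb} => V)}
    {g₂ : PiLp 2 (fun _ : ↥S₂ => V) →ₗ[ℝ] PiLp 2 (fun _ : ↥S₂ => V)}
    (h₁ : Data (resS S₁ ∘ₗ lapL τ bonds cb ∘ₗ extS S₁)
      (qS (embΩ emb) S₁ hΩ₁ τ (eqvW (embEquiv emb) (sigW fun j => wtC d (M j) (l j)))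
        (eqvB (embEquiv emb) (sigB fun j => blockC d (M j) (l j)))
        (eqvΓ (embEquiv emb) (sigΓ fun j => pathC d (M j) (l j)))
        (eqvY (embEquiv emb) (sigY fun j => centreC d (M j) (l j)))) qs₁ A₁ g₁ c₁)
    (h₂ : Data (resS S₂ ∘ₗ lapL τ bonds cb ∘ₗ extS S₂)
      (qS (embΩ emb) S₂ hΩ₂ τ (eqvW (embEquiv emb) (sigW fun j => wtC d (M j) (l j)))
        (eqvB (embEquiv emb) (sigB fun j => blockC d (M j) (l j)))
        (eqvΓ (embEquiv emb) (sigΓ fun j => pathC d (M j) (l j)))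
        (eqvY (embEquiv emb) (sigY fun j => centreC d (M j) (l j)))) qs₂ A₂ g₂ c₂)
    (T : PiLp 2 (fun _ : Xt => V)) {lam₁ : PiLp 2 (fun _ : ↥S₁ => V)} {lam₂ : PiLp 2 (fun _ : ↥S₂ => V)}
    (hq₁ : qS (embΩ emb) S₁ hΩ₁ τ (eqvW (embEquiv emb) (sigW fun j => wtC d (M j) (l j)))
        (eqvB (embEquiv emb) (sigB fun j => blockC d (M j) (l j)))
        (eqvΓ (embEquiv emb) (sigΓ fun j => pathC d (M j) (l j)))
        (eqvY (embEquiv emb) (sigY fun j => centreC d (M j) (l j))) lam₁ = 0)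
    (hq₂ : qS (embΩ emb) S₂ hΩ₂ τ (eqvW (embEquiv emb) (sigW fun j => wtC d (M j) (l j)))
        (eqvB (embEquiv emb) (sigB fun j => blockC d (M j) (l j)))
        (eqvΓ (embEquiv emb) (sigΓ fun j => pathC d (M j) (l j)))
        (eqvY (embEquiv emb) (sigY fun j => centreC d (M j) (l j))) lam₂ = 0)
    (hL₁ : IsLandauBG (resS S₁ ∘ₗ lapL τ bonds cb ∘ₗ extS S₁)
      (qS (embΩ emb) S₁ hΩ₁ τ (eqvW (embEquiv emb) (sigW fun j => wtC d (M j) (l j)))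
        (eqvB (embEquiv emb) (sigB fun j => blockC d (M j) (l j)))
        (eqvΓ (embEquiv emb) (sigΓ fun j => pathC d (M j) (l j)))
        (eqvY (embEquiv emb) (sigY fun j => centreC d (M j) (l j))))
      (resS S₁ T + (resS S₁ ∘ₗ lapL τ bonds cb ∘ₗ extS S₁) lam₁))
    (hL₂ : IsLandauBG (resS S₂ ∘ₗ lapL τ bonds cb ∘ₗ extS S₂)
      (qS (embΩ emb) S₂ hΩ₂ τ (eqvW (embEquiv emb) (sigW fun j => wtC d (M j) (l j)))
        (eqvB (embEquiv emb) (sigB fun j => blockC d (M j) (l j)))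
        (eqvΓ (embEquiv emb) (sigΓ fun j => pathC d (M j) (l j)))
        (eqvY (embEquiv emb) (sigY fun j => centreC d (M j) (l j))))
      (resS S₂ T + (resS S₂ ∘ₗ lapL τ bonds cb ∘ₗ extS S₂) lam₂)) :
    extS S₁ lam₁ = extS S₂ lam₂ :=
  extS_restricted_landau_indep (embΩ emb) τ bonds cb _ _ _ _ hinj hcb
    (isBlockSystem_levels_embed d M l emb bonds hb) S₁ S₂ hΩ₁ hΩ₂ hlayer₁ hlayer₂ h₁ h₂ T hq₁ hq₂ hL₁ hL₂

end Levels

end Literature.MathematicalPhysics.QuantumFieldTheory.Balaban1983to89.B8Thm4LinearDirichlet
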